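import Summits.ABC.ABC.Theses.RibetTakahashiSplit
import Literature.NumberTheory.EllipticCurves.Szpiro
import Literature.NumberTheory.EllipticCurves.SzpiroFreyCurveProofs
import Literature.NumberTheory.EllipticCurves.SzpiroOfAbcProofs
import Literature.NumberTheory.EllipticCurves.PastenValuationProductMestreOesterleProofs
import Literature.NumberTheory.EllipticCurves.RibetTakahashiDefinite

/-!
# The Fermat input of Pasten's cokernel bound where it is known, I: local exponents and the
# semistable case

Helpers (`--supports`) for the stub `stub_fermatInputKnown : FermatInputKnown` of the line
`jl-zero-cycle-height` for the crux `Summit.ABC.ABC.Theses.RibetTakahashiSplit.ManyPrimeValuationProduct`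
(stmt-ABC-1561). The FERMAT INPUT of Pasten's cokernel bound (H. Pasten, *Shimura curves and the
abc conjecture*, arXiv:1705.09251 = J. Number Theory 254 (2024), Thm 6.17) at an elliptic curve
`E/ℚ` and a prime `ℓ ≥ 11` is: some multiplicative prime `r` of `E` has `ℓ ∤ ord_r(Δ_min(E))`.
It is known in print in two cases: (A) `E` semistable — Lemma 6.11 ("Let `ℓ ≥ 11` be a prime
number. Let `E` be a semi-stable elliptic curve over `ℚ`. Then `Δ_E` is not a perfect `ℓ`-th
power"; Mazur's Thm 4, Ribet's level-lowering, Wiles); (B) `E` a Frey–Hellegouarch curve —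
Lemma 6.12 (the odd part of `Δ_E = 2^s (abc)²` is not a perfect `ℓ`-th power, `ℓ ≥ 3`; Wiles,
Ribet 1997, Darmon–Merel 1997). Neither is provable in the tree today (FLT technology); this file
and its sequel `…StubFermatInputKnownFrey` prove everything AROUND those inputs, in the tree's
vocabulary (`WeierstrassCurve.conductorNorm`, `minimalDiscriminantNorm`, `Nat.factorization`,
`Nat.primeFactors`, `freyCurve`), with the skeleton's abbreviations unfolded:
`multPrimes W = (N).primeFactors.filter (¬ ·² ∣ N)`, `FermatInput W = ∀ ℓ prime ≥ 11, ∃ r ∈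
multPrimes W, ¬ ℓ ∣ (Δ_min).factorization r`.

This file:
* `exists_eq_pow_of_dvd_factorization`, `exists_eq_two_pow_mul_pow_of_dvd_factorization` —
  perfect (`ℓ`-th) powers from factorizations with all (odd-prime) exponents `≡ 0 (mod ℓ)`;
* `conductorNorm_eq_of_smul_eq`, `minimalDiscriminantNorm_eq_of_smul_eq` — transport of `N`,
  `Δ_min` (hence of `multPrimes`, `FermatInput`) along `C • W = W'`;
* `factorization_minimalDiscriminantNorm_eq_of_isMinimalAt` (`ord_p Δ_min = v_p Δ(W₀)` for an
  integral equation minimal at `p`), `…_of_not_dvd_c₄`, `factorization_conductorNorm_eq_of_not_dvd_c₄`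
  (`f_p ∈ {0, 1}` when `p ∤ c₄`);
* the twisted Frey–Hellegouarch curve `freyCurve (d a) (d b)` (`a, b` coprime, `ab(a+b) ≠ 0`,
  `d ∣ 2`) at an ODD prime `p`: its integral model is minimal (`isMinimalAt_freyIntModel_twist`),
  `ord_p Δ_min = 2 v_p(ab(a+b))` (`factorization_minimalDiscriminantNorm_freyCurve_twist`) and
  `f_p = [p ∣ ab(a+b)]` (`factorization_conductorNorm_freyCurve_twist`) — the computation behind
  Pasten's Lemma 6.12 for all four twists `d ∈ {±1, ±2}` at once, with no normalisation at `2`;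
* case (A) reduced to its core: `exists_not_dvd_factorization_of_semistable` (from the `ℓ`-th
  power exclusion for semistable curves, stated as an explicit hypothesis) and
  `exists_not_dvd_factorization_of_semistable_of_mestreOesterle` (from the tree's named fact
  `Literature.NumberTheory.EllipticCurves.mestreOesterle1989_thm_1`, for every `ℓ ≥ 6`).

References: H. Pasten, arXiv:1705.09251, §6.5 (Lemmas 6.11, 6.12), §6.8 (Thm 6.17);
J.-F. Mestre, J. Oesterlé, J. reine angew. Math. 400 (1989), Thm 1; E. Bombieri, W. Gubler,
*Heights in Diophantine Geometry* (2006), Ex. 12.5.10; J. H. Silverman, AEC VII.1, VIII.8.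
-/

-- `Summit.ABC.ABC` is the mandated summit-side namespace (CONVENTIONS §2); the duplicate is deliberate.
set_option linter.dupNamespace false

namespace Summit.ABC.ABC.Theorems.ManyPrimeValuationProduct

open WeierstrassCurve Literature.NumberTheory.EllipticCurves

/-! ## Perfect powers from factorizations -/

/-- If every exponent in the factorization of `n ≠ 0` is divisible by `ℓ`, then `n` is a
perfect `ℓ`-th power. `[folklore]` -/
theorem exists_eq_pow_of_dvd_factorization {n ℓ : ℕ} (hn : n ≠ 0)
    (h : ∀ p : ℕ, p.Prime → ℓ ∣ n.factorization p) : ∃ k : ℕ, n = k ^ ℓ := by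
  classical
  -- the `ℓ`-th root, prime by prime
  set f : ℕ →₀ ℕ := n.factorization.mapRange (· / ℓ) (by simp) with hf
  have hfs : ∀ p ∈ f.support, p.Prime := by
    intro p hp
    have : p ∈ n.factorization.support := Finsupp.support_mapRange hp
    exact Nat.prime_of_mem_primeFactors this
  refine ⟨f.prod (· ^ ·), Nat.eq_of_factorization_eq hn (pow_ne_zero _ ?_) fun p => ?_⟩
  · exact Finsupp.prod_ne_zero_iff.mpr fun p hp => pow_ne_zero _ (hfs p hp).ne_zero
  · rw [Nat.factorization_pow, Finsupp.smul_apply, Nat.prod_pow_factorization_eq_self hfs, hf,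
      Finsupp.mapRange_apply, smul_eq_mul]
    by_cases hp : p.Prime
    · exact (Nat.mul_div_cancel' (h p hp)).symm
    · simp [Nat.factorization_eq_zero_of_not_prime _ hp]

/-- If every ODD-prime exponent in the factorization of `n ≠ 0` is divisible by `ℓ ≠ 0`, then
`n = 2 ^ v₂(n) · k ^ ℓ` with `k` odd. `[folklore]` -/
theorem exists_eq_two_pow_mul_pow_of_dvd_factorization {n ℓ : ℕ} (hn : n ≠ 0) (hℓ : ℓ ≠ 0)
    (h : ∀ p : ℕ, p.Prime → p ≠ 2 → ℓ ∣ n.factorization p) :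
    ∃ k : ℕ, Odd k ∧ n = 2 ^ n.factorization 2 * k ^ ℓ := by
  have hn' : ordCompl[2] n ≠ 0 := (Nat.ordCompl_pos 2 hn).ne'
  obtain ⟨k, hk⟩ := exists_eq_pow_of_dvd_factorization hn' (fun p hp => by
    rw [Nat.factorization_ordCompl]
    by_cases hp2 : p = 2
    · subst hp2; simp
    · rw [Finsupp.erase_ne hp2]; exact h p hp hp2)
  refine ⟨k, ?_, ?_⟩
  · have h2 : ¬ 2 ∣ ordCompl[2] n := Nat.not_dvd_ordCompl Nat.prime_two hn
    rw [hk] at h2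
    rw [Nat.odd_iff, ← Nat.two_dvd_ne_zero]
    exact fun h2k => h2 (dvd_pow h2k hℓ)
  · rw [← hk]; exact (Nat.ordProj_mul_ordCompl_eq_self n 2).symm

/-! ## Transport along a `ℚ`-isomorphism `C • W = W'` -/

/-- The conductor is invariant under a change of variables: if `C • W = W'` then `N(W) = N(W')`.
`[folklore]` -/
theorem conductorNorm_eq_of_smul_eq {W W' : WeierstrassCurve ℚ} [W.IsElliptic]
    {C : VariableChange ℚ} (h : C • W = W') : W.conductorNorm ℤ = W'.conductorNorm ℤ := by
  rw [← h, conductorNorm_smul_rat]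

/-- The minimal discriminant is invariant under a change of variables: if `C • W = W'` then
`|Δ_min(W)| = |Δ_min(W')|`. `[folklore]` -/
theorem minimalDiscriminantNorm_eq_of_smul_eq {W W' : WeierstrassCurve ℚ}
    {C : VariableChange ℚ} (h : C • W = W') :
    W.minimalDiscriminantNorm ℤ = W'.minimalDiscriminantNorm ℤ := by
  rw [← h, minimalDiscriminantNorm_smul_rat]

/-! ## Local exponents of an integral equation minimal at `p` -/

/-- For an integral equation `W₀` over `ℤ` that is minimal at the place `v_p`, the exponent of `p`
in `|Δ_min|` is the exponent of `p` in `Δ(W₀)`: `ord_p(Δ_min) = v_p(Δ(W₀))` (Silverman AEC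
VII.1.3, via the discharged `valuation_Δ_eq_of_isMinimalAt_holds`). `[folklore]` -/
theorem factorization_minimalDiscriminantNorm_eq_of_isMinimalAt (W₀ : WeierstrassCurve ℤ)
    [(W₀.baseChange ℚ).IsElliptic] {p : ℕ} (hp : p.Prime)
    (hmin : (W₀.baseChange ℚ).IsMinimalAt ((Rat.HeightOneSpectrum.primesEquiv (R := ℤ)).symm ⟨p, hp⟩)) :
    ((W₀.baseChange ℚ).minimalDiscriminantNorm ℤ).factorization p = W₀.Δ.natAbs.factorization p := by
  set v := (Rat.HeightOneSpectrum.primesEquiv (R := ℤ)).symm ⟨p, hp⟩ with hv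
  have hgen : Rat.HeightOneSpectrum.natGenerator v = p :=
    Literature.NumberTheory.EllipticCurves.Rat.natGenerator_primesEquiv_symm ⟨p, hp⟩
  have hΔ0 : W₀.Δ ≠ 0 := Δ_ne_zero_of_isElliptic_baseChange_int W₀
  have hval := valuation_Δ_eq_of_isMinimalAt_holds v (W₀.baseChange ℚ) hmin
  rw [baseChange_int_Δ] at hval
  rw [factorization_minimalDiscriminantNorm_prime _ hp]
  -- both sides are the largest `k` with `p ^ k ∣ Δ(W₀)`
  have key : ∀ k : ℕ, k ≤ (W₀.baseChange ℚ).ordMinimalDiscriminant v ↔ k ≤ W₀.Δ.natAbs.factorization p := by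
    intro k
    rw [← hp.pow_dvd_iff_le_factorization (Int.natAbs_ne_zero.mpr hΔ0), ← Int.natCast_dvd,
      Nat.cast_pow, ← hgen, ← Literature.NumberTheory.EllipticCurves.Rat.valuation_intCast_le_exp_iff,
      hval, WithZero.exp_le_exp, neg_le_neg_iff, Nat.cast_le]
  exact le_antisymm ((key _).mp le_rfl) ((key _).mpr le_rfl)

/-- For an integral equation `W₀` over `ℤ` with `p ∤ c₄(W₀)` (so minimal at `p`, with good or
multiplicative reduction there): `ord_p(Δ_min) = v_p(Δ(W₀))`. `[folklore]` -/
theorem factorization_minimalDiscriminantNorm_eq_of_not_dvd_c₄ (W₀ : WeierstrassCurve ℤ)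
    [(W₀.baseChange ℚ).IsElliptic] {p : ℕ} (hp : p.Prime) (hc₄ : ¬ (p : ℤ) ∣ W₀.c₄) :
    ((W₀.baseChange ℚ).minimalDiscriminantNorm ℤ).factorization p = W₀.Δ.natAbs.factorization p := by
  refine factorization_minimalDiscriminantNorm_eq_of_isMinimalAt W₀ hp
    (isMinimalAt_baseChange_int_of_not_dvd_c₄ ?_)
  rwa [Literature.NumberTheory.EllipticCurves.Rat.natGenerator_primesEquiv_symm]

/-- For an integral equation `W₀` over `ℤ` with `p ∤ c₄(W₀)`: the conductor exponent at `p` is `1`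
if `p ∣ Δ(W₀)` (multiplicative reduction) and `0` otherwise (good reduction); Bombieri–Gubler
12.5.9. `[folklore]` -/
theorem factorization_conductorNorm_eq_of_not_dvd_c₄ (W₀ : WeierstrassCurve ℤ)
    [(W₀.baseChange ℚ).IsElliptic] {p : ℕ} (hp : p.Prime) (hc₄ : ¬ (p : ℤ) ∣ W₀.c₄) :
    ((W₀.baseChange ℚ).conductorNorm ℤ).factorization p = if (p : ℤ) ∣ W₀.Δ then 1 else 0 := by
  have hgen : Rat.HeightOneSpectrum.natGenerator
      ((Rat.HeightOneSpectrum.primesEquiv (R := ℤ)).symm ⟨p, hp⟩) = p :=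
    Literature.NumberTheory.EllipticCurves.Rat.natGenerator_primesEquiv_symm ⟨p, hp⟩
  have hmin := isMinimalAt_baseChange_int_of_not_dvd_c₄
    (v := (Rat.HeightOneSpectrum.primesEquiv (R := ℤ)).symm ⟨p, hp⟩) (W₀ := W₀) (by rwa [hgen])
  rw [show p = ((⟨p, hp⟩ : Nat.Primes) : ℕ) from rfl, factorization_conductorNorm_primesEquiv_symm]
  split_ifs with hΔ
  · exact conductorExponent_eq_one_of_dvd_Δ_of_not_dvd_c₄ hmin (by rwa [hgen]) (by rwa [hgen])
  · exact conductorExponent_eq_zero_of_not_dvd_Δ hmin (by rwa [hgen])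

/-! ## The Frey–Hellegouarch curve and its twists by `±1, ±2` at an odd prime -/

section Frey

variable {a b d : ℤ} {p : ℕ}

/-- An odd prime does not divide a divisor of `2`. `[folklore]` -/
theorem not_dvd_of_dvd_two (hd : d ∣ 2) (hp : p.Prime) (hp2 : p ≠ 2) : ¬ (p : ℤ) ∣ d := by
  intro h
  have h2 : (p : ℤ) ∣ (2 : ℕ) := h.trans hd
  rw [Int.natCast_dvd_natCast] at h2
  exact hp2 ((Nat.prime_dvd_prime_iff_eq hp Nat.prime_two).mp h2)

/-- For `a, b` coprime, `d ∣ 2` and an odd prime `p`: `p ∤ c₄ = 16 ((da)² + (da)(db) + (db)²)` of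
the integral Frey model of `y² = x (x − da) (x + db)` as soon as `p ∣ ab(a+b)`. `[folklore]` -/
theorem not_dvd_c₄_freyIntModel (hab : IsCoprime a b) (hd : d ∣ 2) (hp : p.Prime) (hp2 : p ≠ 2)
    (hpm : (p : ℤ) ∣ a * b * (a + b)) : ¬ (p : ℤ) ∣ (freyIntModel (d * a) (d * b)).c₄ := by
  have hpint : Prime (p : ℤ) := Nat.prime_iff_prime_int.mp hp
  rw [freyIntModel_c₄, show (16 : ℤ) * ((d * a) ^ 2 + d * a * (d * b) + (d * b) ^ 2) =
    16 * (d * d) * (a ^ 2 + a * b + b ^ 2) by ring]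
  intro h
  rcases hpint.dvd_or_dvd h with h | h
  · rcases hpint.dvd_or_dvd h with h | h
    · exact hp2 (eq_two_of_dvd_sixteen hp h)
    · rcases hpint.dvd_or_dvd h with h | h <;> exact not_dvd_of_dvd_two hd hp hp2 h
  · exact not_dvd_sq_add_mul_add_sq hab hp hpm h

/-- For `a, b` coprime with `ab(a+b) ≠ 0`, `d ∣ 2` and an odd prime `p`, the integral Frey model
`freyIntModel (da) (db)` is minimal at `p`: if `p ∣ ab(a+b)` then `p ∤ c₄`, otherwise `p ∤ Δ`
(Bombieri–Gubler Ex. 12.5.10). `[folklore]` -/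
theorem isMinimalAt_freyIntModel_twist (hab : IsCoprime a b) (hd : d ∣ 2) (hp : p.Prime) (hp2 : p ≠ 2) :
    ((freyIntModel (d * a) (d * b)).baseChange ℚ).IsMinimalAt
      ((Rat.HeightOneSpectrum.primesEquiv (R := ℤ)).symm ⟨p, hp⟩) := by
  have hgen : Rat.HeightOneSpectrum.natGenerator
      ((Rat.HeightOneSpectrum.primesEquiv (R := ℤ)).symm ⟨p, hp⟩) = p :=
    Literature.NumberTheory.EllipticCurves.Rat.natGenerator_primesEquiv_symm ⟨p, hp⟩
  have hpint : Prime (p : ℤ) := Nat.prime_iff_prime_int.mp hp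
  by_cases hpm : (p : ℤ) ∣ a * b * (a + b)
  · exact isMinimalAt_baseChange_int_of_not_dvd_c₄ (by rw [hgen]; exact not_dvd_c₄_freyIntModel hab hd hp hp2 hpm)
  · refine isMinimalAt_baseChange_int_of_not_pow_dvd_Δ ?_
    rw [hgen, freyIntModel_Δ, show (16 : ℤ) * (d * a * (d * b) * (d * a + d * b)) ^ 2 =
      16 * (d * d * d) ^ 2 * (a * b * (a + b)) ^ 2 by ring]
    intro h
    have h1 : (p : ℤ) ∣ 16 * (d * d * d) ^ 2 * (a * b * (a + b)) ^ 2 :=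
      (dvd_pow_self (p : ℤ) (by norm_num)).trans h
    rcases hpint.dvd_or_dvd h1 with h1 | h1
    · rcases hpint.dvd_or_dvd h1 with h1 | h1
      · exact hp2 (eq_two_of_dvd_sixteen hp h1)
      · have h2 := hpint.dvd_of_dvd_pow h1
        rcases hpint.dvd_or_dvd h2 with h2 | h2
        · rcases hpint.dvd_or_dvd h2 with h2 | h2 <;> exact not_dvd_of_dvd_two hd hp hp2 h2
        · exact not_dvd_of_dvd_two hd hp hp2 h2
    · exact hpm (hpint.dvd_of_dvd_pow h1)

/-- The exponent of an odd prime in `|d|³`-type factors vanishes: for `d ∣ 2` and odd `p`,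
`v_p(|d a d b (d a + d b)|) = v_p(|ab(a+b)|)`. `[folklore]` -/
theorem factorization_natAbs_twist (hd : d ∣ 2) (hp : p.Prime) (hp2 : p ≠ 2) (h0 : a * b * (a + b) ≠ 0) :
    (d * a * (d * b) * (d * a + d * b)).natAbs.factorization p = (a * b * (a + b)).natAbs.factorization p := by
  have hd0 : d ≠ 0 := by rintro rfl; simp at hd
  rw [show d * a * (d * b) * (d * a + d * b) = (d * d * d) * (a * b * (a + b)) by ring, Int.natAbs_mul,
    Nat.factorization_mul (by simp [hd0]) (Int.natAbs_ne_zero.mpr h0), Finsupp.add_apply]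
  suffices h : (d * d * d).natAbs.factorization p = 0 by rw [h, zero_add]
  rw [Nat.factorization_eq_zero_iff]
  refine Or.inr (Or.inl fun h => ?_)
  have : (p : ℤ) ∣ d * d * d := Int.natCast_dvd.mpr h
  have hpint : Prime (p : ℤ) := Nat.prime_iff_prime_int.mp hp
  rcases hpint.dvd_or_dvd this with h2 | h2
  · rcases hpint.dvd_or_dvd h2 with h2 | h2 <;> exact not_dvd_of_dvd_two hd hp hp2 h2
  · exact not_dvd_of_dvd_two hd hp hp2 h2

/-- **Frey exponents at odd primes.** For `a, b` coprime with `ab(a+b) ≠ 0`, `d ∣ 2` and an odd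
prime `p`: `ord_p Δ_min(E) = 2 v_p(ab(a+b))` for the twisted Frey–Hellegouarch curve
`E : y² = x (x − da) (x + db)` (the integral model is minimal at `p` with `Δ = 16 d⁶ (ab(a+b))²`;
Bombieri–Gubler Ex. 12.5.10, Pasten arXiv:1705.09251 proof of Lemma 6.12). `[folklore]` -/
theorem factorization_minimalDiscriminantNorm_freyCurve_twist (hab : IsCoprime a b)
    (h0 : a * b * (a + b) ≠ 0) (hd : d ∣ 2) (hp : p.Prime) (hp2 : p ≠ 2) :
    ((freyCurve (d * a) (d * b)).minimalDiscriminantNorm ℤ).factorization p =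
      2 * (a * b * (a + b)).natAbs.factorization p := by
  have hd0 : d ≠ 0 := by rintro rfl; simp at hd
  have h0' : d * a * (d * b) * (d * a + d * b) ≠ 0 := by
    rw [show d * a * (d * b) * (d * a + d * b) = (d * d * d) * (a * b * (a + b)) by ring]
    exact mul_ne_zero (by simp [hd0]) h0
  haveI := isElliptic_freyIntModel h0'
  rw [← baseChange_freyIntModel,
    factorization_minimalDiscriminantNorm_eq_of_isMinimalAt _ hp (isMinimalAt_freyIntModel_twist hab hd hp hp2),
    freyIntModel_Δ, Int.natAbs_mul, Int.natAbs_pow,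
    Nat.factorization_mul (by norm_num) (pow_ne_zero _ (Int.natAbs_ne_zero.mpr h0')),
    Finsupp.add_apply, Nat.factorization_pow, Finsupp.smul_apply, smul_eq_mul,
    factorization_natAbs_twist hd hp hp2 h0]
  have h16 : (16 : ℤ).natAbs.factorization p = 0 := by
    rw [show (16 : ℤ).natAbs = 2 ^ 4 by rfl, Nat.factorization_pow, Finsupp.smul_apply,
      Nat.prime_two.factorization, Finsupp.single_apply, if_neg (Ne.symm hp2), smul_zero]
  rw [h16, zero_add]

/-- **Frey conductor at odd primes.** For `a, b` coprime with `ab(a+b) ≠ 0`, `d ∣ 2` and an odd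
prime `p`: the exponent of `p` in the conductor of `y² = x (x − da) (x + db)` is `1` if
`p ∣ ab(a+b)` (multiplicative reduction) and `0` otherwise (Frey 1986; Bombieri–Gubler
Ex. 12.5.10). `[folklore]` -/
theorem factorization_conductorNorm_freyCurve_twist (hab : IsCoprime a b)
    (h0 : a * b * (a + b) ≠ 0) (hd : d ∣ 2) (hp : p.Prime) (hp2 : p ≠ 2) :
    ((freyCurve (d * a) (d * b)).conductorNorm ℤ).factorization p =
      if (p : ℤ) ∣ a * b * (a + b) then 1 else 0 := by
  have hd0 : d ≠ 0 := by rintro rfl; simp at hd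
  have h0' : d * a * (d * b) * (d * a + d * b) ≠ 0 := by
    rw [show d * a * (d * b) * (d * a + d * b) = (d * d * d) * (a * b * (a + b)) by ring]
    exact mul_ne_zero (by simp [hd0]) h0
  haveI := isElliptic_freyCurve h0'
  have hfac := factorization_minimalDiscriminantNorm_freyCurve_twist hab h0 hd hp hp2
  have hpf : ((freyCurve (d * a) (d * b)).minimalDiscriminantNorm ℤ).primeFactors =
      ((freyCurve (d * a) (d * b)).conductorNorm ℤ).primeFactors :=
    primeFactors_minimalDiscriminantNorm _
  split_ifs with hpm
  · -- multiplicative reduction: compute on the integral model, minimal at `p` as `p ∤ c₄`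
    haveI := isElliptic_freyIntModel h0'
    have h := factorization_conductorNorm_eq_of_not_dvd_c₄ (freyIntModel (d * a) (d * b)) hp
      (not_dvd_c₄_freyIntModel hab hd hp hp2 hpm)
    rw [baseChange_freyIntModel] at h
    rw [h, if_pos]
    rw [freyIntModel_Δ, show d * a * (d * b) * (d * a + d * b) = (d * d * d) * (a * b * (a + b)) by ring]
    exact dvd_mul_of_dvd_right (dvd_pow (dvd_mul_of_dvd_right hpm _) two_ne_zero) _
  · -- good reduction: `p ∤ Δ_min`, so `p ∤ N`
    have hv : (a * b * (a + b)).natAbs.factorization p = 0 := by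
      rw [Nat.factorization_eq_zero_iff]
      exact Or.inr (Or.inl fun h => hpm (Int.natCast_dvd.mpr h))
    rw [hv, mul_zero] at hfac
    by_contra hne
    have hmem : p ∈ ((freyCurve (d * a) (d * b)).conductorNorm ℤ).primeFactors := by
      rw [← Nat.support_factorization]; exact Finsupp.mem_support_iff.mpr hne
    rw [← hpf, ← Nat.support_factorization, Finsupp.mem_support_iff] at hmem
    exact hmem hfac

end Frey

/-! ## Case (A): semistable curves -/

/-- For a squarefree conductor every prime factor is multiplicative: the multiplicative primes
are all the prime factors. `[folklore]` -/
theorem filter_not_sq_dvd_eq_primeFactors {N : ℕ} (hss : ∀ p : ℕ, p.Prime → ¬ p ^ 2 ∣ N) :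
    N.primeFactors.filter (fun p => ¬ p ^ 2 ∣ N) = N.primeFactors :=
  Finset.filter_true_of_mem fun p hp => hss p (Nat.prime_of_mem_primeFactors hp)

/-- `p² ∤ N` for every prime `p` means `N` squarefree, i.e. `W` semistable (Silverman ATAEC
IV.10.2, via the proved `isSemistable_iff_squarefree_conductorNorm`). `[folklore]` -/
theorem isSemistable_of_forall_not_sq_dvd (W : WeierstrassCurve ℚ) [W.IsElliptic]
    (hss : ∀ p : ℕ, p.Prime → ¬ p ^ 2 ∣ W.conductorNorm ℤ) : W.IsSemistable ℤ := by
  rw [isSemistable_iff_squarefree_conductorNorm, Nat.squarefree_iff_prime_squarefree]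
  exact fun p hp h => hss p hp (by rwa [sq])

/-- **Case (A) of the Fermat input (semistable curves), reduced to its published core.** If no
semistable elliptic curve over `ℚ` has minimal discriminant `|Δ_min| = k ^ ℓ` with `k ≥ 2` — for a
prime `ℓ ≥ 11` this is Pasten, arXiv:1705.09251, Lemma 6.11 ("Let `ℓ ≥ 11` be a prime number. Let
`E` be a semi-stable elliptic curve over `ℚ`. Then `Δ_E` is not a perfect `ℓ`-th power": Mazur's
Thm 4 + Ribet's level-lowering + Wiles), equivalently the `ℓ ≥ 11` exclusion in the proof of
Mestre–Oesterlé's Théorème 1 (`mestreOesterle1989_thm_1_iff_cases`) — then every elliptic `W/ℚ`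
with squarefree conductor `N ≠ 1` has a (multiplicative) prime `r ∣ N` with `ℓ ∤ ord_r(Δ_min)`:
otherwise every exponent of `|Δ_min|` (whose primes are those of `N`) is a multiple of `ℓ` and
`|Δ_min| ≥ 2` is a perfect `ℓ`-th power. `[folklore]` -/
theorem exists_not_dvd_factorization_of_semistable {ℓ : ℕ}
    (hℓ : ∀ (W : WeierstrassCurve ℚ) [W.IsElliptic], W.IsSemistable ℤ →
      ∀ k : ℕ, 2 ≤ k → W.minimalDiscriminantNorm ℤ ≠ k ^ ℓ)
    (W : WeierstrassCurve ℚ) [W.IsElliptic] (hss : ∀ p : ℕ, p.Prime → ¬ p ^ 2 ∣ W.conductorNorm ℤ)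
    (hN : (W.conductorNorm ℤ).primeFactors.Nonempty) :
    ∃ r ∈ (W.conductorNorm ℤ).primeFactors.filter (fun p => ¬ p ^ 2 ∣ W.conductorNorm ℤ),
      ¬ ℓ ∣ (W.minimalDiscriminantNorm ℤ).factorization r := by
  by_contra hall
  push Not at hall
  rw [filter_not_sq_dvd_eq_primeFactors hss, ← primeFactors_minimalDiscriminantNorm] at hall
  rw [← primeFactors_minimalDiscriminantNorm] at hN
  have hΔ0 : W.minimalDiscriminantNorm ℤ ≠ 0 := (minimalDiscriminantNorm_pos_holds W).ne'
  have hΔ1 : W.minimalDiscriminantNorm ℤ ≠ 1 := by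
    intro h1; rw [h1, Nat.primeFactors_one] at hN; exact Finset.not_nonempty_empty hN
  obtain ⟨k, hk⟩ := exists_eq_pow_of_dvd_factorization hΔ0 fun p hp => by
    by_cases hmem : p ∈ (W.minimalDiscriminantNorm ℤ).primeFactors
    · exact hall p hmem
    · rw [← Nat.support_factorization, Finsupp.notMem_support_iff] at hmem
      rw [hmem]; exact dvd_zero _
  have hk2 : 2 ≤ k := by
    by_contra hlt
    interval_cases k
    · rcases Nat.eq_zero_or_pos ℓ with hℓ0 | hℓ0
      · exact hΔ1 (by rw [hk, hℓ0, pow_zero])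
      · exact hΔ0 (by rw [hk, zero_pow hℓ0.ne'])
    · exact hΔ1 (by rw [hk, one_pow])
  exact hℓ W (isSemistable_of_forall_not_sq_dvd W hss) k hk2 hk

/-- **Registered sub-goal of `stub_fermatInputKnown` (case (A), semistable curves): the Fermat
input for a curve with squarefree conductor `N ≠ 1` at the exponent `ℓ`, from the `ℓ`-th power
exclusion for semistable curves** (Pasten, arXiv:1705.09251, Lemma 6.11 for prime `ℓ ≥ 11`;
Mestre–Oesterlé 1989 Thm 1 for `ℓ ≥ 6`). Binder-free restatement of
`exists_not_dvd_factorization_of_semistable` (the form registered with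
`ledger workitem stub-add stmt-ABC-1561 --name fermatInput_of_semistable_of_powExclusion`).
`[folklore]` -/
theorem fermatInput_of_semistable_of_powExclusion : ∀ (ℓ : ℕ), (∀ (W : WeierstrassCurve ℚ) [W.IsElliptic], W.IsSemistable ℤ → ∀ k : ℕ, 2 ≤ k → W.minimalDiscriminantNorm ℤ ≠ k ^ ℓ) → ∀ (W : WeierstrassCurve ℚ) [W.IsElliptic], (∀ p : ℕ, p.Prime → ¬ p ^ 2 ∣ W.conductorNorm ℤ) → (W.conductorNorm ℤ).primeFactors.Nonempty → ∃ r ∈ (W.conductorNorm ℤ).primeFactors.filter (fun p => ¬ p ^ 2 ∣ W.conductorNorm ℤ), ¬ ℓ ∣ (W.minimalDiscriminantNorm ℤ).factorization r :=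
  fun _ hℓ W _ hss hN => exists_not_dvd_factorization_of_semistable hℓ W hss hN

/-- **Case (A) from the tree's named fact `mestreOesterle1989_thm_1`** (Mestre–Oesterlé 1989,
Théorème 1: a semistable `E/ℚ` with `|Δ_min|` an `m`-th power of an integer `≥ 2` has `m ≤ 5`):
for every `ℓ ≥ 6` and every elliptic `W/ℚ` with squarefree conductor `N ≠ 1`, some prime `r ∣ N`
has `ℓ ∤ ord_r(Δ_min)`. Conditional on that named fact only. `[folklore]` -/
theorem exists_not_dvd_factorization_of_semistable_of_mestreOesterle
    (hMO : mestreOesterle1989_thm_1) {ℓ : ℕ} (h6 : 6 ≤ ℓ)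
    (W : WeierstrassCurve ℚ) [W.IsElliptic] (hss : ∀ p : ℕ, p.Prime → ¬ p ^ 2 ∣ W.conductorNorm ℤ)
    (hN : (W.conductorNorm ℤ).primeFactors.Nonempty) :
    ∃ r ∈ (W.conductorNorm ℤ).primeFactors.filter (fun p => ¬ p ^ 2 ∣ W.conductorNorm ℤ),
      ¬ ℓ ∣ (W.minimalDiscriminantNorm ℤ).factorization r :=
  exists_not_dvd_factorization_of_semistable
    (fun W' _ hW' k hk hΔ => by have := hMO W' hW' ℓ k hk hΔ; omega) W hss hN

end Summit.ABC.ABC.Theorems.ManyPrimeValuationProduct
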